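import Mathlib
import HarnessLib
import HarnessLib.Audit
import Summits.QuantumFields.Statement
import Literature.MathematicalPhysics.QuantumLattice.LatticeWilsonFlow

/-!
Route: FlowLineStateSpace

DORMANT since 2026-09-03T05:50:13Z (reconciler: no traction for 5 d (last activity item-proof-filed at 2026-08-29T05:14:31Z); parked, not closed — `ledger route dormant route-QuantumFields-FlowLineStateSpace --off` to reactivate) — unstaffed, not closed; items shared with open routes are served there. `ledger route dormant <id> --off` reactivates.

# Route FlowLineStateSpace — Flow-line state space in d=4 — flowed curvature fields tight mod gauge
from ONE non-concentration bound (chessboard-reduced), species as t→0 boundary values, assembled on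
⁰𝒮

It suffices to show X = MassiveScalingSequence ∧ CurvatureNonGaussianity ∧ RotationRestoration ∧
OSLimitFromUniformBounds
(the last conjunct is the soft OS-limit assembly — a CRUX since 2026-08-16: it is unproved and a
hypothesis of the deciding
theorem `closes`, and deciding theorems may assume crux items only), realising card
flow-line-state-space-4d (spine; no other card linked). MassiveScalingSequence (MSS):
for every compact simple G there are a faithful unitary lattice representation r and an
asymptotically free SEQUENTIAL Wilson
scheme (β_k → ∞, exact vacuum subtraction) along which the torus n-point functionals S_k of the
renormalised curvature field
c_k a_k⁴(tr-plaquette density − m_k), evaluated on GENERAL off-diagonal tensors F ∈ ⁰𝒮, obey (UVB)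
k-uniform OS linear-growth
bounds |S_k(F)| ≤ α(n!)^β|F|_{ns}, (ND) a k-uniform lower bound on the OS two-point form S_k(θf*⊗g),
(CL) k-uniform exponential
clustering at a physical rate in OS form, (ARP) asymptotic reflection positivity of the S_k, and
(GAP) the statement's own uniform
lattice gap HasLatticeMassGap. The UV half
(UVB, ND; ARP is lattice reflection positivity up to o(1)) is the OUTPUT of the card's flow
programme: push the lattice measures along the Wilson gradient flow to physical flow
time t, obtain tightness modulo gauge of the flowed fields from ONE k-uniform NON-CONCENTRATION
bound on the flowed energy
— in its minimal typed form the UNIFORM INTEGRABILITY of the flowed action density along the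
t₀-scheme (crux
FlowedEnergyNonConcentration, typed 2026-08-15 over the landed lattice Wilson flow and flow scale:
scale setting pins the first
moments, so Markov gives O(R⁴) for the Hong–Tian entropy functional for free and tightness is
exactly the little-o, carried by
the typed supports EntropyNonConcentrationFromUI and LatticeEntropyEpsilonRegularity;
chessboard-reduced to a one-sided tilted
free energy) — and recover the curvature species as t → 0 boundary values of the immortal flow lines
(informal crux
SmallFlowTimeReconstruction). The IR half (CL, GAP) and RotationRestoration (E1) are imported
complements; CurvatureNonGaussianity is the card's
non-triviality clause from short-flow-time asymptotics. UV and IR sit in ONE existential on purpose: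
separately quantified halves
are satisfied by junk schemes whose nominal spacing a_k is mis-scaled against the physical spacing
(UVB+ND pin a_k from below,
CL/GAP from above). The typed layer is written over existing declarations only (wilsonMeasure,
torusLift, configShift, box,
LatticeRep.curvature, SpeciesScheme, HasLatticeMassGap, OSData, IsYangMillsFor, IsOffDiagonal,
IsTimeOrdered, osAdjoint,
schwartzNorm, linActMulti, translateMulti, IsWilsonFlowLine, plaquetteHolonomy; since 2026-08-16 the
flow scale t₀ = flowScaleOf
is INLINED as `sInf {τ | 0 < τ ∧ 3/10 ≤ τ²·⟨e_τ⟩}` — definitionally equal, `Iff.rfl` — so that the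
route file imports
QuantumLattice.LatticeWilsonFlow only: FlowScale.lean's `import LatticeGaugeProofs` dragged 7
modules and 9 unproved
strong-coupling facts (Sweep1/LatticeGauge) into the import cone that no item uses); every item
elaborates (lean check rc 0; each one-liner opens the Literature namespaces with a term-level `open
… in` and binds the torus measure μ k and
the functional LS k n F with `let`, to stay under the gate's 4000-char cap) and the deciding theorem
`closes : MSS → NG → ROT → OSL → YangMills`
(glue.lean; all four hypotheses crux items) and the assembly are proved sorry-free (planner's
Sketch.lean, rc 0 without the FlowScale import).
Lean: `MassiveScalingSequence ∧ CurvatureNonGaussianity ∧ RotationRestoration ∧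
OSLimitFromUniformBounds`

## Assembly
Pure logic (sorry-free `assembly_holds` in Sketch.lean/GateSim.lean): fix G and the instances;
MassiveScalingSequence gives
(r, sch) with AF, VS, UVB, ND, CL, ARP, GAP; CurvatureNonGaussianity and RotationRestoration turn
(VS, UVB, ND, CL) into NG and ROT;
OSLimitFromUniformBounds turns everything into (sch', T) with all five clauses of `YangMills`, and
⟨r, sch', T, …⟩ closes the
goal. The flow-level cruxes (FlowedEnergyNonConcentration, SmallFlowTimeReconstruction) and supports
(FlowedEnergyMeanBound,
FlowedEnergyMomentBound, EntropyNonConcentrationFromUI, LatticeEntropyEpsilonRegularity,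
TightnessModGaugeFromUI,
ChessboardReduction, FlowLineLaw) feed MassiveScalingSequence's UV half and CurvatureNonGaussianity
in layer 2.

Rationale: WHY THIS LINE. Mechanism (card flow-line-state-space-4d, after Charalambous–Gross and Cao–Chatterjee
arXiv:2111.12813 / arXiv:2111.10652 in d = 3, Lüscher arXiv:1006.4518, Lüscher–Weisz
arXiv:1101.0963): regularise OBSERVABLES, not the action, by the gauge-covariant Wilson gradient
flow at a physical scale √(8t); at t > 0 the flowed composites are honest random fields (the smeared
plaquette is not: its lattice variance is ∼ a⁻⁴), so the existence leg becomes tightness of a law on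
immortal Yang–Mills flow lines C((0,∞); 𝒜/𝒢) plus the t → 0 boundary behaviour of a smooth path, and
the lattice flow never meets the rough-data criticality that stops noise-driven constructions in d =
4. Imported areas: geometric analysis of the Yang–Mills heat flow — entropy monotonicity and
small-entropy regularity (Hamilton1993 §3, ChenShen1994, HongTian2004 Thm 2/4 = KelleherStreets2018
Thm 12/15, Struwe1994 Thm 2.3(iii)/2.4(i), eqs (12)–(13)), Uhlenbeck1982 gauges, long-time existence
(Waldron2019); reflection-positivity thermodynamics (chessboard estimates,
FrohlichIsraelLiebSimon1978 §4) converting the ONE needed one-point bound into a one-sided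
free-energy bound uniform in a — the currency of ultraviolet-stability theorems
(Balaban1988Convergent Cor. 3, Balaban1989LargeFieldII, MagnenRivasseauSeneor1993); the
practitioners' flow technology (t₀ scale setting, 4+1-d locality). What the route adds: BPST
instantons are fixed points of the flow, so at fixed t > 0 flowed configurations contain
near-instantons of every size (a²t)^{1/4} ≲ ρ ≪ √t and tightness in C^m mod gauge can NOT follow
from moment bounds (pointwise moments of E_t are k-uniform only below order b₀/4 = 11h∨/12, 1.83 for
SU(2)); it must come from NON-CONCENTRATION, as a mechanism (promote-to-A, 2026-08-15): (1) MONOTONE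
QUANTITIES — the Wilson action is lattice-exactly non-increasing along the flow (Lüscher 2010 p. 2;
dissipation identity dS_w(V_t)/dt = −‖Z(V_t)‖²) and Hamilton's entropy Z(t) = (T−t)²∫|F_t|²k is
pathwise non-increasing and EXACT on the flat 4-torus (Hamilton1993 §3), so a concentration at scale
R at (x,T) is a tower Φ ≥ ε₀ at every scale from √T down to R; (2) SCALE SETTING PINS FIRST MOMENTS
— s²E_k[E_s(0)] ≤ 0.3 for s ≤ 1 is the DEFINITION of t₀ (support FlowedEnergyMeanBound; s<1 half
proved in the planner's SanityMean.lean), hence Markov gives P(Φ_{(x,t)}(R) ≥ ε₀) = O(R⁴) for free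
while tightness needs o(R⁴) over the R⁻⁴ centres of a box: the tier-deciding crux is EXACTLY the
little-o, and truncation E = E∧λ + (E−λ)₊ shows little-o ⟸ UNIFORM INTEGRABILITY of the flowed
one-point density (typed FlowedEnergyNonConcentration; typed reduction
EntropyNonConcentrationFromUI; deterministic engine LatticeEntropyEpsilonRegularity); (3) UI ⟺ no
energy defect in the limit — the ensemble form of Struwe's bubbling: bubbles cost ≥ ε₀ each
(Struwe1994 Thm 2.4(i): non-trivial Yang–Mills connections on S⁴ separate), UI says the number
density of bubbles of vanishing size → 0 uniformly in the cutoff; dilute gas: energy fraction in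
sizes < ρ ∝ ρ^{b₀−4}, so UI ⟺ b₀ > 4 with margin 10/3 for every simple G. WHY THIS FORM IS EASIER
(MassiveScalingSequence is summit-strength by design): existence is transferred to laws on smooth
flow lines, where NAMED tools closed the analogous deterministic statements (Struwe1994 Thm 2.3,
HongTian2004 Thm 4, Waldron2019 Thm 1.1, Uhlenbeck compactness, Prokhorov), and the probabilistic
input shrinks to ONE one-point functional E[(E_s−Λ)₊] of a flowed composite that perturbation theory
controls to all orders without composite renormalisation (LuscherWeisz2011) and lattice practice
measures routinely — versus the unflowed plaquette (variance ∼ a⁻⁴). Typed layer: `YangMills` is ∀G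
∃(r, sch, T), so the deliverable is ONE pinned existential (MSS) with ∀-companions robust to
non-uniqueness of subsequential limits; the flow items quantify over torus flow lines B via the
tree's IsWilsonFlowLine (unique on a finite torus) because matrixWilsonFlow on ℤ⁴ chooses an
arbitrary entrywise flow line (not unique on the infinite lattice); negatives index re-read
2026-08-16T06Z: 4 refuted statements (3 QCD, 1 DiagonalMirrorRP), none touching
flow/entropy/OS-limit items.

RANKED CRUXES. #2 MassiveScalingSequence (crux, typed, stamped) — ∃ pinned AF Wilson scheme with
(AF, VS, UVB, ND, CL, ARP, GAP) for the renormalised curvature species on ⁰𝒮; UV half = output of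
the flow chain, IR half imported; one existential because the halves pin a_k ≍ a_phys only jointly
[open-problem]. #3 FlowedEnergyNonConcentration (crux, typed; tier-deciding; REPAIRED TWICE
2026-08-15/16, inlined t₀ 2026-08-16) — for every compact simple G there EXISTS a faithful unitary
lattice rep r (chosen per G: exactly the ∃ r of MassiveScalingSequence and of `YangMills`) such that
along every asymptotically free t₀-scheme of r (β_k → ∞, t₀ → ∞, L/√t₀ → ∞) the physical flowed
action density t₀²e(s·t₀, 0) is uniformly integrable on every flow-time window, ∀δ ∃Λ ∀k ∀s,
E_k[(E−Λ)₊] ≤ δ. Quantifier history: the all-r typing fell on paper to refuter g47-1 (SU(2) spin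
3/2: a metastable plaquette gives a flow-stable single-link defect gas, weight e^{−17.5β} ≫ a⁴ ≍
e^{−215β}, which sets t₀ and sends t₀²e → 0 in probability at fixed mean 0.3); the minimal-dimension
typing H_min fell on paper to refuter rattack-13977-0 (Spin(4m), m ≥ 5: minimal dimension forces V ⊕
S+, whose central ω is a strict metastable plaquette; Spin(20): S_def = 240 < S_crit = 311); the
obstruction is entropic (defect weight e^{−Sβ} against a⁴ ≍ exp(−96π²T(r)β/(11h∨))) and
REPRESENTATION-dependent — for each G some r passes the single-plaquette test (census in NUMBERS) —
hence ∃ r (= the refuter's recommended C'_A); first moments free (FlowedEnergyMeanBound), stronger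
L^p form FlowedEnergyMomentBound (same ∃ r shape; predicted for 1 < p < 11h∨/12), consumers
EntropyNonConcentrationFromUI (INSTANCE-WISE, true by Markov + translation invariance) →
LatticeEntropyEpsilonRegularity → TightnessModGaugeFromUI → FlowLineLaw [open-problem; why it might
fail: for some G EVERY faithful r could carry energy in flow-stable lumps of vanishing size —
physical small instantons, or COLLECTIVE centre-blind lattice defects when G is not simply connected
(SO(3): S_crit = 86.1; the planner's scans kit j007679/j007927/j013373 find Z₂-monopole world-lines
of tension 6.8 ± 0.7 per cube whose contractible loops all collapse under the flow — only
torus-WRAPPING lines are local minima, excluded by L_k → ∞ — so no relevant flow-stable SO(3) defect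
is known); any proof must see asymptotic freedom non-perturbatively]. #4 SmallFlowTimeReconstruction
(crux, informal; = W2 of card flow-first-localise-later) — the curvature species as t → 0 boundary
values: c(t)-renormalised flowed n-point functionals converge to the unflowed renormalised ones
uniformly-eventually in k on off-diagonal tensors (composite renormalisation of tr F² relocated to
the small-flow-time expansion) [XL; typing deferred: it is a conjunction feeding UVB ∧ ND whose
non-degeneracy clause must be fixed together with the FlowSchemeUV split]. #5
CurvatureNonGaussianity (crux, typed, stamped) — a connected three-point function of the curvature
species stays away from 0 infinitely often [XL]. #6 RotationRestoration (crux, typed, stamped;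
imported E1) [open-problem]. #7 OSLimitFromUniformBounds (crux since 2026-08-16, re-badged from
support because it is unproved and a hypothesis of `closes`, which may assume crux items only;
typed, L, provable-now in principle, lowest crux priority) — the soft assembly: one diagonal
subsequence converging on all of ⁰𝒮 (UVB equicontinuity + separability), Hahn–Banach extension to
𝒮-continuous functionals, E0'/E1–E4, IsNontrivial (ND + VS), IsNonGaussian (NG; the subsequence
chosen inside its ∃ᶠ set), HasMassGap (time part of CL) and HasLatticeMassGap (reindexed GAP)
through the limit, other species renormalised to 0 [why it might fail: a mismatch with the tree's
witness-form OS fields, or the complex non-normed Hahn–Banach step; OsterwalderSchrader1975,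
GlimmJaffe1987 Thm 6.1.3]. Supports: FlowedEnergyMeanBound (typed, M), FlowedEnergyMomentBound
(typed, open), LatticeEntropyEpsilonRegularity (typed, deterministic, L),
EntropyNonConcentrationFromUI (typed, M), TightnessModGaugeFromUI (informal, L), ChessboardReduction
(informal), FlowLineLaw (informal), Assembly (:= closes).

TWO-LAYER PLAN. MassiveScalingSequence ⇐ FlowSchemeUV ∧ FlowSchemeIR for the canonical t₀-scheme
(split to be filed in tenure; deliberately not yet): FlowSchemeUV = AF ∧ VS ∧ UVB ∧ ND ⇐
FlowedEnergyNonConcentration →(EntropyNonConcentrationFromUI, LatticeEntropyEpsilonRegularity,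
TightnessModGaugeFromUI)→ tight flow-line laws →(FlowLineLaw)→ SmallFlowTimeReconstruction;
FlowSchemeIR = CL ∧ GAP ("m√t₀ bounded below", gap cards). FlowedEnergyNonConcentration ⇐ EITHER (α)
ChessboardReduction → a ONE-SIDED tilted free-energy bound f_k(h,Λ)/h ≤ δ(Λ) uniformly in a for the
Wilson action tilted by +hΣ_blocks(Ē_block − Λ)₊ (a bounded non-negative block function of the
block-truncated flow; chessboard: E[(Ē−Λ)₊] ≤ f_k/h) — Bałaban/MRS currency, but for one observable
at one sign of h — OR (β) FlowedEnergyMomentBound for one p ∈ (1, 11h∨/12). CurvatureNonGaussianity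
⇐ three-point short-flow-time asymptotics (free Wick-square triangle > 0). Glue at each node is
∧-introduction or the typed implications already filed.

KILL CRITERIA. Refutation of MassiveScalingSequence (e.g. every AF Wilson sequence with UVB ∧ ND
violates CL, or UVB fails for tr F² along every pinned sequence) closes the route and every
compactness-type existence line with it. Refutation of FlowedEnergyNonConcentration as typed (∃ r
per G, β_k → ∞) — a G for which EVERY faithful r admits an admissible t₀-scheme along which
E_k[(E_s−Λ)₊] ↛ 0, i.e. an ENERGY DEFECT: flow-stable lumps of vanishing PHYSICAL size keep a
positive fraction of ⟨E⟩ — kills tightness in C^m for EVERY flow-based line when the lumps are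
physical (small instantons: the defect is then a property of the laws, not of the method): pivot to
distributional topologies (Cao–Chatterjee orbit spaces) or close
refuted:FlowedEnergyNonConcentration; the same theorem refutes FlowedEnergyMomentBound for all p >
1. If instead the witness is a LATTICE-SCALE artefact shared by all representations of ONE class of
groups (π₁-monopoles of the centre-blind reps of a non-simply-connected G, e.g. SO(3), should they
prove flow-stable), the line survives for simply connected G and needs, for the quotients, a
universality transfer G̃ → G of the continuum data or a monopole-free discretisation — restate with
that restriction plus a support, do not close (precedents: spin-3/2 vs the all-r typing → H_min,
2026-08-15; Spin(20) vs H_min → ∃ r, 2026-08-16). NOT a witness: hot-start endpoints on small tori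
made of torus-WRAPPING monopole world-lines (kit j007927) — a collective-defect refutation must
exhibit a CONTRACTIBLE (null-homologous) flow-stable configuration with S < S_crit, reproducible on
a larger torus. FlowedEnergyMomentBound refuted only for p ≥ 11h∨/12 CONFIRMS the instanton tail
(expected, not fatal). LatticeEntropyEpsilonRegularity or EntropyNonConcentrationFromUI refuted ⇒
the planner's reduction is wrong as typed: restate (supports), not close. RotationRestoration
refuted for a pinned Wilson sequence refutes E1 for Wilson's action (fatal for all Wilson routes).
CurvatureNonGaussianity refuted ⇒ the curvature limit is generalised-free (fatal for all routes).
OSLimitFromUniformBounds (crux #7) refuted as stated ⇒ restate the soft assembly (never fatal: it is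
bookkeeping over the tree's OS fields). A Bałaban-style proof of MSS's UV half without the flow
moots the flow cruxes but not the route.

NOT DECOMPOSED YET. The FlowSchemeUV/IR split of MassiveScalingSequence and the typing of
SmallFlowTimeReconstruction (its non-degeneracy clause and the a²/t bookkeeping); the
block-truncation Lipschitz lemma for the nonlinear flow (Lüscher's locality with Gaussian tails) and
the even-side auxiliary tori inside ChessboardReduction; the higher-derivative version of
LatticeEntropyEpsilonRegularity and the lattice Uhlenbeck/Coulomb gauge inside
TightnessModGaugeFromUI; the nuclear-space bookkeeping inside OSLimitFromUniformBounds; the lattice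
proof of ARP inside MSS's UV half. The s ≥ 1 half of FlowedEnergyMeanBound waits for the deferred
facts of defn-latticeWilsonFlow (torus existence/uniqueness, unitarity, action monotonicity,
translation covariance; provable in Theorems with --supports). Infinite volume is NOT a node
(L_k/√t₀ → ∞ is a hypothesis; every flow item is local). WHICH r a prover should pick is guided by
hand/kit checks, not items: the single-plaquette test for r = ⊕R_i (central z metastable iff Σ_i
T(R_i)λ_i(z) > 0, relevant iff 6Σ_i d_i(1 − λ_i(z)) < 96π²Σ_i T(R_i)/(11h∨), plus a torus scan for
non-central minima — refuter rattack-13977-0) and a multi-link flow scan from Haar-random starts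
with kick test, clover Q and a WINDING check of every monopole cycle (kit j007679/j007927/j013373
template, < 8 core-hours); current picks: minimal irrep for SU(N), Sp(N), Spin(2k+1), G₂, F₄, E₆,
E₇, E₈; S+ ⊕ S− for Spin(4m); vector for SO(N) and adjoint for PSU(N) provisionally (monopole-line
tension ≈ 6.8 resp. ≈ 6.6(N−1) per cube, contractible loops collapse in every run so far; a
larger-torus scan of SO(5)/PSU(3) is the cheapest remaining check). Layer-2 children only after a
crux closes.

CHEAPEST FALSIFIER. (a) PUBLISHED INSTANTON SIZE DISTRIBUTIONS (runnable today): UI ⟺ integrability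
at 0 of the density of flow-stable lumps; SmithTeper1998 (hep-lat/9801008, eqs (A5)–(A6) and §4.6
with Table 'tail-small'): SU(3) small-ρ tail D(ρ) ∝ ρ^{γ_s} with γ_s drifting to the predicted 6 =
b₀ − 5 as a and the number of cooling sweeps decrease; ForcrandPerezStamatescu1997 (hep-lat/9701012)
for SU(2), prediction ρ^{7/3}; a measured small-ρ exponent γ_s ≤ −1 stable under a → 0 would kill UI
this week, γ_s > −1 is consistent. (b) VARIANCE DRIFT (one kit job or existing t₀ ensembles): at
fixed s/t₀ the pointwise variance ⟨(t²E_t(x))²⟩ should drift upward ∝ a^{−1/3} for SU(2) (p = 2 >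
1.83) and be a-stable for SU(3) (2 < 2.75) at pinned mean — calibrates FlowedEnergyMomentBound,
never kills UI; an a-stable exponential BOX moment would make the chessboard line (α) strictly
easier. (c) LEAN-CHEAP: FlowedEnergyMeanBound (s<1: done in the sketch),
EntropyNonConcentrationFromUI and OSLimitFromUniformBounds are provable now; failure to prove either
of the last two exposes a flaw in the reduction / soft assembly itself. (d) Photon sanity
(non-simple U(1), excluded): t²⟨E_t⟩ is t-independent for a free field, so the t₀-scheme is
uninhabited or degenerate there — the hypotheses, not the conclusion, fail exactly where YangMills
is false. (e) DEFECT SCAN per (G, r) (by hand for single plaquettes, one kit job for multi-link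
candidates): list the critical points of Re χ_r on the maximal torus and compare the cost 6·(d_r −
Re χ_r(g*)) of every non-identity local maximum g* with the a⁴-rate 96π²T(r)/(11h∨); the ∃ r crux
dies on paper for a G as soon as EVERY faithful r shows a relevant flow-stable defect
(single-plaquette, or collective: Z_N-monopole loops of centre-blind reps) — cheapest candidates: a
CONTRACTIBLE flow-stable Z₂-monopole configuration of the SO(3)-vector action (none among loops of
length ≤ 12, kit j013373; longer loops cost > 86.1 at tension 6.8/cube), SO(5) vector (S_crit =
28.7), PSU(3) adjoint (Z₃ cube ≈ 13), Sp(2) spinor / SU(3) fundamental multi-link minima below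
14.35; for simply connected G the census finds a passing r everywhere (smallest margin SU(2): 24 vs
21.5, −1 unstable; SU(2)-fundamental flow reached S = 0 from all 16 seeds).

NUMBERS. b₀ = 11h∨/3 (SU(N): 11N/3); one-loop density ∝ ρ^{b₀−5}dρ d⁴x (tHooft1976; Coleman §3.6);
E_inst(0) = 48/ρ⁴, ∫E = 8π² per instanton; pointwise tail P(E_s(0) > λ) ∼ λ^{−b₀/4} ⇒ moments
k-uniform iff p < b₀/4 (SU(2) 1.83, SU(3) 2.75); UI rate u(λ) = sup E[(E−λ)₊] ∼ λ^{−(b₀−4)/4},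
energy fraction below size ρ ∼ ρ^{b₀−4} (SU(2): ρ^{10/3}, SU(3): ρ⁷), hence P(Φ_{(x,t)}(R) ≥ ε₀) ∼
R^{b₀} ≪ R⁴; lattice lifetime of a size-ρ instanton under Wilson flow ∼ ρ⁴/a²; free first moment:
s²⟨E_s⟩ ≤ 0.3 (s ≤ 1), ⟨E_s⟩ ≤ 0.3 (s ≥ 1) in t₀ = 1 units; lattice entropy functional
Φ^{lat}_{(x,s)}(R) = Σ_y exp(−d(x,y)²/(4R²t₀)) e((s−R²)t₀, y) = 32π²·Φ_{HongTian}, Σ_y exp(…) ≤ C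
R⁴t₀² for R²t₀ ≥ 1; ε-regularity window 1 ≤ t ≤ S²/64 (lattice units); ⟨E_t⟩ = 3(N²−1)g²(q =
1/√(8t))/(128π²t²)(1 + O(g²)) (Luscher2010WilsonFlow eq. (2.32)); t₀: t²⟨E⟩ = 0.3 = the inlined
`sInf {τ | 0 < τ ∧ 3/10 ≤ τ²⟨e_τ⟩}` (= flowScaleOf by rfl), √(8t₀) ≈ 0.47 fm. ITEMS (2026-08-16): 10
typed (cruxes MSS, FENC, NG, ROT, OSL; supports FlowedEnergyMeanBound, FlowedEnergyMomentBound,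
LatticeEntropyEpsilonRegularity, EntropyNonConcentrationFromUI; Assembly) + 4 informal (crux
SmallFlowTimeReconstruction; supports ChessboardReduction, FlowLineLaw, TightnessModGaugeFromUI) =
14 ≤ 15, cruxes 6 ≤ 7. DEFECT CENSUS (why '∃ r': single-plaquette test S_def = 6(d_r − Re χ_r(g*))
at a local minimum g* vs the a⁴-rate S_crit = 96π²T(r)/(11h∨); full tables in EVIDENCE-13917.md
(refuter g47-1, 2026-08-15) and EVIDENCE-13977.md + Cprime.lean (refuter rattack-13977-0,
2026-08-16) on the predecessor items, and in this file's git history rev ≤ 21): RELEVANT stable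
defects exist for SU(2) spin 3/2 (17.47 < 215) and for Spin(4m ≥ 20) with r = V ⊕ S+ (48m < S_crit;
Spin(20): 240 < 311) — the two on-paper witnesses that forced '∀ r' → 'minimal dimension' → '∃ r';
NO relevant stable defect for SU(N) fundamental (SU(2): 24 > 21.5 and unstable; SU(3): ≥ 24 > 14.4,
no local minimum; SU(4): 24 > 10.8 saddle; N ≥ 5: ≈ 118/N > 43/N), SO(2k+1)/Sp(k) vector, Spin(2k+1)
spinor, S+ ⊕ S− of Spin(4m), E₈ adjoint (1344 ≫ 86.1); SO(3) vector: f_V ≤ 4 per plaquette vs 86.1,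
and the collective Z₂-monopole objects found by the planner's flow scans (kit j007679, j007927,
j013373 on 4⁴/6⁴: line tension 6.8 ± 0.7 per cube, clover Q ≈ 0, kick-stable) are ALL torus-wrapping
world-lines, while 16/16 seeded contractible loops of length 4–12 and every contractible loop of 29
random starts collapse to S = 0 — cost ≈ 6.8·(2L_k+1), excluded by L_k → ∞; SU(2) fundamental: 0
stuck endpoints in 16 runs. Item lineage: 9432 → 13917 → 13977 → 14094 (FENC), 13919 → 13980 →
14095, 13915 → 13981 → 14096; the 2026-08-16 inlining restates 14094/13914/14095/14096 once more,
definitionally (Iff.rfl, planner's DefEq.lean).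

DEFINITION REQUESTS. D1–D3 LANDED (2026-08-15):
Literature.MathematicalPhysics.QuantumLattice.{IsWilsonFlowLine, matrixWilsonFlow, wilsonFlowMatrix,
latticeWilsonFlow, flowedEnergy, flowedClover(Energy)} (LatticeWilsonFlow.lean), {flowScaleOf,
flowScale, flowProfile, FlowSchemeData.toSpeciesScheme} (FlowScale.lean), {IsYangMillsHeatFlow,
FlowLine, FlowLineSpace, Waldron2019_yangMillsFlow_flatTorus} (YangMillsHeatFlow*.lean). D4
(hygiene, filed 2026-08-15 --for this route): on ℤ⁴ the entrywise flow lines of IsWilsonFlowLine are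
not unique, so `matrixWilsonFlow (range ρ) t (torusLift S U)` is an unspecified flow line and
FlowSchemeData's intended `E t Ũ = flowedEnergy ρ t 0 Ũ` is not provably the torus flow; request:
restrict matrixWilsonFlow to the bounded flow line (unique in ℓ^∞ by Gronwall) or prove the
periodic-lift lemma; until then the flow items quantify over torus flow lines. D5 (import hygiene,
2026-08-16): FlowScale.lean imports QuantumFieldTheory.LatticeGaugeProofs (→ LatticeGauge, Sweep1,
StrongCouplingActivities: 9 unproved strong-coupling facts, none used here) only for
isProbabilityMeasure_wilsonMeasure; request: re-home flowScaleOf/flowScaleSet and their lemmas in an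
import-light module — this route inlines the sInf meanwhile. Cite facts wanted (acq filed):
HongTian2004 Thm 2 and Thm 4 (doi:10.1007/s00208-004-0539-9), ChenShen1994 (acq-04107), Struwe1994
full text (acq-02702), MagnenRivasseauSeneor1993 (acq-03968).

Novelty: Searches (2026-08-15): `lean search 'Wilson ?flow|gradient ?flow|heat ?flow|YangMillsFlow'` over
Mathlib + project (1333 hits, all
scalar heat flow in FluidPDE/RH files; no gauge-field flow: D1–D3 are genuinely missing); `ledger
negatives --problem
QuantumFields` (0 refuted statements); `lit galaxy search "Yang-Mills flow in four dimensions"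
--star all` (4 rows: Struwe 1994
pdf:-918522333281787800 read pp. 1–4, Thm 2.3(iii)/2.4 quoted; Feehan arXiv:1906.03954; Kelleher
thesis 2017); `lit galaxy
search "small instantons gradient flow" --star all` (0); `lit galaxy search "Yang-Mills heat
equation" --star all` (9 rows: Struwe,
Feehan, Kelleher again; Lévy YM₂; the Friz–König proceedings holding ChatterjeeYMProb2019; no d = 4
flow state space); `lit galaxy
search "instanton size distribution" --star pdf` (2, phenomenology); `lit galaxy search "heat flow
regularization" --star all` (3, Ricci
bounds, unrelated); `lit search` ×4 and `lit frontier` attempted — searchd unavailable (rc 75,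
13:55–14:45Z), so the card's searches (lit read arXiv:2111.12813 grep d=4; Oberwolfach Report
59/2023; lit frontier
QuantumFields --since 2020, 30 rows; galaxy "lattice Yang-Mills at strong coupling") and the refuter
audit of the card
(new-combination; prior art list below) are relied on and cited, not repeated.
Nearest prior art found: arXiv:2111.12813 = doi:10.1007/s00220-023-04870-y and arXiv:2111.10652
(Cao–Chatterjee: flow-regularised
state space and 'free-field behaviour ⇒ tightness', d = 3, ro  [refs: 10.1007/s00220-023-04870-y, 10.1007/s00220-012-1558-0, 10.1007/BF01191339, 10.4310/cag.1993.v1.n1.a7, 1906.03954, 2111.12813, 2111.10652, 1101.0963, 1610.03424, hep-lat/9801008, 1602.03125, doi:10.1007/s00220-023-04870-y, doi:10.1007/s00220-012-1558-0, doi:10.1007/BF01191339, doi:10.4310/cag.1993.v1.n1.a7, ChatterjeeYMProb2019, FrohlichIsraelLiebSimon1978, Hamilton1993, Struwe1994, SmithTeper1998,]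

Barriers (technique_class: gradient-flow-state-space, chessboard-moment-reduction): - technique_class: gradient-flow-state-space, chessboard-moment-reduction
- Literature.Barriers.QuantumFields.StochasticQuantisationCriticality: evaded — no noise-driven
singular SPDE and no local-subcriticality hypothesis; the lattice flow is an ODE on a compact
manifold and the continuum flow runs only from tight smooth data at t ≥ t₀ (Waldron), which is
exactly what avoids the d = 4 criticality of flowing ROUGH data. The revision's monotone quantities
(Wilson action along the lattice flow; Hamilton entropy on the flat torus) are deterministic and
pathwise, so no renormalised-noise object appears anywhere.
- Literature.Barriers.QuantumFields.UVStabilityNonUniqueness: embraced, not fought —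
MassiveScalingSequence asks for k-uniform BOUNDS (UVB) plus lower bounds, and
OSLimitFromUniformBounds extracts a subsequence, which the sequential statement (ruling Y2:
IsYangMillsFor along a sequence WE choose) allows; Jaffe–Witten's fn. 2 proviso ('unless one also
establishes the axioms and the gap') is met by CL/GAP/ROT and the OS verification. The bet is that
chessboard estimates let stability-type free-energy bounds control every flowed correlator, not just
log Z. Sharpened by the revision: stability-type free-energy bounds are needed for ONE one-sided
tilt by a bounded non-negative block function ((Ē−Λ)₊ of the block-truncated flowed energy) at one
sign of h — an upper bound on one tilted pressure, not two-sided control of log Z's derivatives; and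
the barrier theorem exists_isUVSta

Novelty grade: new-combination — ROUTE REVIEW gen 4 (refuter rreview-0815T13-13-g4-0, 2026-08-15) — KEEP OPEN; concurring pass after g40-61/g41-50/g41-16/g41-25/g2/g3 (not a recombination; QuantumFields negatives empty). 5/5 typed decls rc0 today (W2.lean, built module; Assembly := closes); informal 9432/9456–9459 untypable pending (refuter refuter-rreview-0815T13-13-g4-0, 2026-08-15T15:48:02Z; prior: CaoChatterjee arXiv:2111.12813 = doi:10.1007/s00220-023-04870-y; arXiv:2111.10652, CharalambousGross doi:10.1007/s00220-012-1558-0, Luscher arXiv:1006.4518; LuscherWeisz arXiv:1101.0963; arXiv:1308.5598, Struwe1994 doi:10.1007/BF01191339; Waldron arXiv:1610.03424, FrohlichIsraelLiebSimon1978 §4; Balaban1989LargeFieldII; OsterwalderSeiler1978, ChatterjeeYMProb2019 Problem 5.1)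

History (route lifecycle, newest last):
- 2026-08-16T00:17:05Z · rev 17: restated FlowedEnergyNonConcentration (stmt-QuantumFields-13977) — repair: FlowedEnergyNonConcentration (stmt-13977) refuted-misstated ON PAPER by refuter rattack-13977-0 (Spin(20), r = 20 ⊕ 512 forced by H_min: metastable cent (planner-rrefute-QuantumFields-FlowLineStateSpa-02d90ee0-0)
- 2026-08-16T00:17:38Z · rev 18: restated EntropyNonConcentrationFromUI (stmt-QuantumFields-13980) — repair (2 of 3): EntropyNonConcentrationFromUI (stmt-13980, support) restated 1:1 as the INSTANCE-WISE reduction (∀ G r β L B: t₀-scheme conditions → UI for thi (planner-rrefute-QuantumFields-FlowLineStateSpa-02d90ee0-0)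
- 2026-08-16T00:18:05Z · rev 19: restated FlowedEnergyMomentBound (stmt-QuantumFields-13981) — repair (3 of 3): FlowedEnergyMomentBound (stmt-13981, support; the stronger L^p form of the crux) restated 1:1 in the same '∃ r per G' shape as the repaired cru (planner-rrefute-QuantumFields-FlowLineStateSpa-02d90ee0-0)
- 2026-08-16T06:11:54Z · rev 24: restated FlowedEnergyNonConcentration (stmt-QuantumFields-14094), FlowedEnergyMeanBound (stmt-QuantumFields-13914), EntropyNonConcentrationFromUI (stmt-QuantumFields-14095), FlowedEnergyMomentBound (stmt-QuantumFields-14096) — route-repair gen 2 (rbadge-4f0ed896-g2), part B — RE-ROUTE AROUND the import cone: th (planner-rbadge-QuantumFields-FlowLineStateSpac-4f0ed896-g2-0)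
- 2026-08-16T17:35:48Z · rev 25: restated OSLimitFromUniformBounds (stmt-QuantumFields-9120) — route-repair (statement-revised p116790: `YangMills` gained the first conjunct `sch.HasWeakCouplingLimit`): OSLimitFromUniformBounds (stmt-9120, crux rank 9, un (planner-rrepair-QuantumFields-FlowLineStateSpa-f1598c89-0)
- 2026-08-23T02:25:55Z · DORMANT — reconciler: no traction for 5.8 d (last activity item-evidence-added at 2026-08-17T05:34:35Z); parked, not closed — `ledger route dormant route-QuantumFields-Fl (operator:999:3591368)
- 2026-08-28T21:15:13Z · REACTIVATED — reconciler: reactivated — activity item-proof-filed at 2026-08-28T18:54:22Z after parking at 2026-08-23T02:25:55Z (operator:999:2273505)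
- 2026-09-03T05:50:13Z · DORMANT — reconciler: no traction for 5 d (last activity item-proof-filed at 2026-08-29T05:14:31Z); parked, not closed — `ledger route dormant route-QuantumFields-FlowLin (operator:999:222055)

sub-problem: YangMills · status: dormant · opened planner-plancard-QuantumFields-YangMills-flow-fbd92c18-0 2026-08-15T13:49:57Z · rev 25 · ledger route-QuantumFields-FlowLineStateSpace
GENERATED by the gate from the ledger (D-0016/17). Provers cite these decls: `theorem foo : Summit.QuantumFields.YangMills.Theses.FlowLineStateSpace.<Decl> := …` in Summits/QuantumFields/YangMills/Theorems/<Name>.lean.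
-/

namespace Summit.QuantumFields.YangMills.Theses.FlowLineStateSpace

open scoped BigOperators Topology Manifold Classical MeasureTheory ProbabilityTheory Matrix InnerProductSpace ComplexConjugate ContinuousMap
open Filter Set Function TopologicalSpace MeasureTheory

attribute [summit_statement] _root_.YangMills

/-- item stmt-QuantumFields-9117 · crux · rank 2 · open · by planner
why it might fail: UV half = non-perturbative composite renormalisation of tr F² along AF, never achieved in d=4 (UV-stability bounds exist only for log Z, SU(2), schematic); IR half = Chatterjee's open uniform lattice gap (Problem 5.1); and ONE sequence must carry both, in commensurate units.
sources: Balaban1989LargeFieldII, Balaban1988Convergent, arXiv:1101.0963, arXiv:2111.12813, ChatterjeeYMProb2019, JaffeWitten2000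
[crux] For every compact simple G (borel σ-algebra) there are r : LatticeRep G and sch :
SpeciesScheme (YMSpecies G) with: (AF) β_k → ∞; (VS) m_k(curvature) = the torus vacuum expectation
of the action density at (β_k, side 2L_k+1); (UVB) ∃ s α β, ∀ n, ∀ off-diagonal complex n-point
tensors F, eventually in k, |S_k(F)| ≤ α (n!)^β schwartzNorm(ns) F, where S_k(F) = ∫ Σ_{x∈box^n}
F(a_k x) ∏_i c_k a_k⁴ (O(τ_{x_i}Ũ) − m_k) dμ_{β_k,2L_k+1} is the torus n-point functional of the
renormalised curvature species on general tensors; (ND) ∃ time-ordered one-point f, g and H = θf*⊗g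
with |S_k(H)| ≥ δ > 0 eventually; (CL) ∃ Δ > 0, ∀ time-ordered F, G ∃ C ∀ translations v with v⁰ ≥
0, eventually in k, |S_k(θF*⊗τ_vG) − S_k(θF*)S_k(G)| ≤ C e^{−Δ‖v‖} (time part = gap, spatial part =
E4); (ARP) asymptotic reflection positivity of the S_k in the finite-list E2 form (∀ ε, eventually
Re Σ_ij S_k(θF_i*⊗F_j) ≥ −ε, |Im| ≤ ε — exact lattice site-RP moves the time-plaquettes of the
corner action density by one unit, so RP of S_k holds only up to o(1)); (GAP) ∃ Δ > 0,
HasLatticeMassGap r sch Δ. UV half (UVB, ND, ARP) = t → 0 output of FlowedEnergyNonConcentration →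
FlowedTightness → SmallFlowTimeReconstructi -/
@[route_item "route-QuantumFields-FlowLineStateSpace"]
def MassiveScalingSequence : Prop :=
  open Literature.MathematicalPhysics.QuantumFieldTheory Literature.MathematicalPhysics.QuantumLattice Literature.MathematicalPhysics.AQFT Literature.Probability.LatticeModels in ∀ (G : Type) [Group G] [TopologicalSpace G] [IsTopologicalGroup G] [CompactSpace G], IsCompactSimpleLieGroup G → letI : MeasurableSpace G := borel G; haveI : BorelSpace G := ⟨rfl⟩; ∃ (r : LatticeRep G) (sch : SpeciesScheme (YMSpecies G)), let μ := fun k : ℕ => wilsonMeasure (d := 4) (L := sch.side k) r.ρ (sch.β k); let LS := fun (k n : ℕ) (F : SchwartzMap (Fin n → EuclideanSpace ℝ (Fin 4)) ℂ) => (∫ U, ∑ x : Fin n → ↥(box 4 (sch.L k)), F (fun i => sch.a k • siteToE ↑(x i)) * ∏ i, ((sch.c r.curvature k * sch.a k ^ 4 * (r.curvature.F (configShift (-↑(x i)) (torusLift (sch.side k) U)) - sch.m r.curvature k) : ℝ) : ℂ) ∂μ k); Filter.Tendsto sch.β Filter.atTop Filter.atTop ∧ (∀ k : ℕ, sch.m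 r.curvature k = ∫ U, r.curvature.F (torusLift (sch.side k) U) ∂μ k) ∧ (∃ (s : ℕ) (α β : ℝ), ∀ (n : ℕ) (F : SchwartzMap (Fin n → EuclideanSpace ℝ (Fin 4)) ℂ), IsOffDiagonal F → ∀ᶠ k in Filter.atTop, ‖LS k n F‖ ≤ α * (n.factorial : ℝ) ^ β * schwartzNorm (n * s) F) ∧ (∃ (f g : SchwartzMap (Fin 1 → EuclideanSpace ℝ (Fin 4)) ℂ) (H : SchwartzMap (Fin (1 + 1) → EuclideanSpace ℝ (Fin 4)) ℂ), IsTimeOrdered f ∧ IsTimeOrdered g ∧ IsAppendTensorOf H (osAdjoint f) g ∧ ∃ δ : ℝ, 0 < δ ∧ ∀ᶠ k in Filter.atTop, δ ≤ ‖LS k (1 + 1) H‖) ∧ (∃ Δ : ℝ, 0 < Δ ∧ ∀ (n m : ℕ) (F : SchwartzMap (Fin n → EuclideanSpace ℝ (Fin 4)) ℂ) (G' : SchwartzMap (Fin m → EuclideanSpace ℝ (Fin 4)) ℂ), IsTimeOrdered F → IsTimeOrdered G' → ∃ C : ℝ, ∀ v : EuclideanSpace ℝ (Fin 4), 0 ≤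 v 0 → ∀ᶠ k in Filter.atTop, ∀ H : SchwartzMap (Fin (n + m) → EuclideanSpace ℝ (Fin 4)) ℂ, IsAppendTensorOf H (osAdjoint F) (translateMulti v G') → ‖LS k (n + m) H - LS k n (osAdjoint F) * LS k m G'‖ ≤ C * Real.exp (-Δ * ‖v‖)) ∧ (∀ (N : ℕ) (deg : Fin N → ℕ) (F : (j : Fin N) → SchwartzMap (Fin (deg j) → EuclideanSpace ℝ (Fin 4)) ℂ), (∀ j, IsTimeOrdered (F j)) → ∀ H : (i j : Fin N) → SchwartzMap (Fin (deg i + deg j) → EuclideanSpace ℝ (Fin 4)) ℂ, (∀ i j, IsAppendTensorOf (H i j) (osAdjoint (F i)) (F j)) → ∀ ε : ℝ, 0 < ε → ∀ᶠ k in Filter.atTop, -ε ≤ (∑ i, ∑ j, LS k (deg i + deg j) (H i j)).re ∧ |(∑ i, ∑ j, LS k (deg i + deg j) (H i j)).im| ≤ ε) ∧ (∃ Δ : ℝ, 0 < Δ ∧ HasLatticeMassGap r sch Δ)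

-- earlier FlowedEnergyNonConcentration (stmt-QuantumFields-13917, replaced 2026-08-15T23:34:43Z -> stmt-QuantumFields-13977): retired by None — open Literature.MathematicalPhysics.QuantumFieldTheory Literature.MathematicalPhysics.QuantumLattice Literature.Probability.LatticeModels in ∀ (G : Type) [Group G] [TopologicalSpace G] [IsTopologicalGroup G] [CompactSpace G], IsCompactSimpleLieGroup G → letI
-- earlier FlowedEnergyNonConcentration (stmt-QuantumFields-13977, replaced 2026-08-16T00:17:05Z -> stmt-QuantumFields-14094): retired by None — open Literature.MathematicalPhysics.QuantumFieldTheory Literature.MathematicalPhysics.QuantumLattice Literature.Probability.LatticeModels in ∀ (G : Type) [Group G] [TopologicalSpace G] [IsTopologicalGroup G] [CompactSpace G], IsCompactSimpleLieGroup G → letI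
-- earlier FlowedEnergyNonConcentration (stmt-QuantumFields-14094, replaced 2026-08-16T06:11:54Z -> stmt-QuantumFields-14705): retired by None — open Literature.MathematicalPhysics.QuantumFieldTheory Literature.MathematicalPhysics.QuantumLattice Literature.Probability.LatticeModels in ∀ (G : Type) [Group G] [TopologicalSpace G] [IsTopologicalGroup G] [CompactSpace G], IsCompactSimpleLieGroup G → letI
-- earlier FlowedEnergyNonConcentration (stmt-QuantumFields-9432, replaced 2026-08-15T23:08:59Z -> stmt-QuantumFields-13917): retired by None — [crux] (card flow-line-state-space-4d K1 = (Y1), sharpened by the planner; needs definition requests D1 latticeWilsonFlow and D2 flowScale before it can be typed) For compact simple G, a faithful unitary rep r and an asymptotically free coupling sequence β_k 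
/-- item stmt-QuantumFields-14705 · crux · rank 3 · open · by planner
why it might fail: Fails iff for some G every faithful r keeps energy in flow-stable lumps of vanishing size — small instantons (dilute gas: no) or centre-blind collective defects (SO(3) Z₂-monopole lines: tension 6.8/cube, contractible loops collapse, only torus-wrapping lines are minima, j013373); needs AF
sources: Luscher2010, Luscher2010WilsonFlow, LuscherWeisz2011, BhanotCreutz1981, HallidaySchwimmer1981, ForcrandJahn2002
[crux] (card K1; tier-deciding; REPAIRED TWICE 2026-08-15/16 after on-paper witnesses —
EVIDENCE-13917.md (g47-1), EVIDENCE-13977.md + Cprime.lean (rattack-13977-0) on the predecessors;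
RESTATED DEFINITIONALLY 2026-08-16 from stmt-14094, Iff.rfl) UNIFORM INTEGRABILITY OF THE FLOWED
ACTION DENSITY FOR A WELL-CHOSEN DISCRETISING REPRESENTATION. For every compact simple Lie group G
there EXISTS a faithful unitary lattice representation r (chosen per G — exactly the '∃ r' that
MassiveScalingSequence and `YangMills` consume; = refuter rattack-13977-0's recommended repair C'_A)
such that for EVERY asymptotically free sequence (H_AF: β_k → ∞), torus half-sides L_k and torus
Wilson flow lines B_k in r (tree IsWilsonFlowLine, unique on a finite torus), with e_k(τ,x,U) =
2Σ_{i<j}(N − Re tr r.ρ(P_{x,ij}(B_k τ U))) and t₀(k) = inf{τ > 0 : τ²⟨e_τ⟩ ≥ 3/10} (= flowScaleOf,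
INLINED 2026-08-16 so the route drops the FlowScale import; defeq), the t₀-scheme conditions t₀(k) >
0, t₀(k) → ∞, L_k/√t₀(k) → ∞ imply: on every window [t₁,t₂] ⊂ (0,∞) the physical densities X_s^{(k)}
:= t₀(k)²·e_k(s·t₀(k),0) are uniformly integrable, ∀δ ∃Λ ∀k ∀s∈[t₁,t₂]: E_k[(X_s^{(k)} − Λ)₊] ≤ δ.
WHY '∃ r'. Typing 1 (stmt-13 -/
@[route_item "route-QuantumFields-FlowLineStateSpace"]
def FlowedEnergyNonConcentration : Prop :=
  open Literature.MathematicalPhysics.QuantumFieldTheory Literature.MathematicalPhysics.QuantumLattice Literature.Probability.LatticeModels in ∀ (G : Type) [Group G] [TopologicalSpace G] [IsTopologicalGroup G] [CompactSpace G], IsCompactSimpleLieGroup G → letI : MeasurableSpace G := borel G; haveI : BorelSpace G := ⟨rfl⟩; ∃ r : LatticeRep G, ∀ (β : ℕ → ℝ) (L : ℕ → ℕ) (B : (k : ℕ) → ℝ → GaugeConfig 4 (2 * L k + 1) G → GaugeConfig 4 (2 * L k + 1) G), (∀ (k : ℕ) (U : GaugeConfig 4 (2 * L k + 1) G), IsWilsonFlowLine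 (Set.range r.ρ) (fun e => r.ρ (U e)) (fun s e => r.ρ (B k s U e))) → let μ := fun k : ℕ => wilsonMeasure (d := 4) (L := 2 * L k + 1) r.ρ (β k); let e := fun (k : ℕ) (τ : ℝ) (x : Site 4 (2 * L k + 1)) (U : GaugeConfig 4 (2 * L k + 1) G) => (2 * ∑ i : Fin 4, ∑ j : Fin 4, if i < j then ((r.N : ℝ) - (r.ρ (plaquetteHolonomy (B k τ U) x i j)).trace.re) else 0 : ℝ); let t0 := fun k : ℕ => sInf {τ : ℝ | 0 < τ ∧ 3 / 10 ≤ τ ^ 2 * ∫ U, e k τ 0 U ∂μ k}; Filter.Tendsto β Filter.atTop Filter.atTop → (∀ k, 0 < t0 k) → Filter.Tendsto t0 Filter.atTop Filter.atTop → Filter.Tendsto (fun k : ℕ => (L k : ℝ) / Real.sqrt (t0 k)) Filter.atTop Filter.atTop → ∀ t₁ t₂ : ℝ, 0 < t₁ → t₁ ≤ t₂ → ∀ δ : ℝ, 0 < δ → ∃ Λ : ℝ, ∀ (k : ℕ) (s : ℝ), s ∈ Set.Icc t₁ t₂ → ∫ U, max (t0 k ^ 2 * e k (s * t0 k) 0 U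 - Λ) 0 ∂μ k ≤ δ

-- item stmt-QuantumFields-9456 · crux · rank 4 · open · by planner — informal only, no Lean statement yet:
--   [crux] (card K2 = (Y3); = W2 of the sibling card flow-first-localise-later; needs D1–D3) Given
--   tightness mod gauge of the flowed curvature fields at every physical flow time t > 0 along the
--   t₀-scheme (from FlowedEnergyNonConcentration via FlowedTightnessFromNonConcentration) and the
--   identification of limits as laws on continuum flow lines (FlowLineLaw): there are c(t) > 0 (∝ the tr
--   F² field renormalisation, running logarithmically) and m(t) such that for every n and every
--   off-diagonal tensor F ∈ ⁰𝒮 the double limit lim_{t→0} lim_{k} c(t)^n Σ/∫ F(x) E_k[∏_i (E_t(x_i) −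
--   m(t))] exists with remain

/-- item stmt-QuantumFields-9118 · crux · rank 5 · open · by planner
why it might fail: needs a quantitative asymptotic-freedom expansion of a composite THREE-point function, non-perturbatively and uniformly in k — no method controls short distances of the constructed theory; the one known shortcut, a β-derivative (action-insertion) identity, gives κ₃ at ONE configuration only.
sources: arXiv:1308.5598, arXiv:1304.0533, arXiv:1101.0963, ChatterjeeYMProb2019
[crux] For every G, r, sch satisfying (VS), (UVB), (ND), (CL) of MassiveScalingSequence (these pin
the nominal spacing to the physical one from both sides), some three-point function of the
renormalised curvature field stays away from zero infinitely often: ∃ complex one-point f, g, h and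
an off-diagonal tensor F₃ = f⊗g⊗h, ∃ δ > 0, ∃ᶠ k, |S_k(F₃)| ≥ δ (by (VS) the one-point functions
vanish on the scheme's own tori, so S_k(F₃) IS the connected three-point function and the limit
field is not generalised-free). Card mechanism: the t → 0 / short-distance asymptotics of flowed
three-point functions are asymptotically free, with leading term the free Wick-square triangle ∝ dim
G · C(x−y)C(y−z)C(z−x), strictly non-zero; '∃ᶠ' makes the item robust to non-unique subsequential
limits. [deps: MassiveScalingSequence] [difficulty: XL] -/
@[route_item "route-QuantumFields-FlowLineStateSpace"]
def CurvatureNonGaussianity : Prop :=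
  open Literature.MathematicalPhysics.QuantumFieldTheory Literature.MathematicalPhysics.QuantumLattice Literature.MathematicalPhysics.AQFT Literature.Probability.LatticeModels in ∀ (G : Type) [Group G] [TopologicalSpace G] [IsTopologicalGroup G] [CompactSpace G], IsCompactSimpleLieGroup G → letI : MeasurableSpace G := borel G; haveI : BorelSpace G := ⟨rfl⟩; ∀ (r : LatticeRep G) (sch : SpeciesScheme (YMSpecies G)), let μ := fun k : ℕ => wilsonMeasure (d := 4) (L := sch.side k) r.ρ (sch.β k); let LS := fun (k n : ℕ) (F : SchwartzMap (Fin n → EuclideanSpace ℝ (Fin 4)) ℂ) => (∫ U, ∑ x : Fin n → ↥(box 4 (sch.L k)), F (fun i => sch.a k • siteToE ↑(x i)) * ∏ i, ((sch.c r.curvature k * sch.a k ^ 4 * (r.curvature.F (configShift (-↑(x i)) (torusLift (sch.side k) U)) - sch.m r.curvature k) : ℝ) : ℂ) ∂μ k); (∀ k : ℕ, sch.m r.curvature k = ∫ U, r.curvature.F (torusLift (sch.side k) U) ∂μ k) → (∃ (s : ℕ) (α β : ℝ), ∀ (n : ℕ) (F : SchwartzMap (Fin n → EuclideanSpace ℝ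 (Fin 4)) ℂ), IsOffDiagonal F → ∀ᶠ k in Filter.atTop, ‖LS k n F‖ ≤ α * (n.factorial : ℝ) ^ β * schwartzNorm (n * s) F) → (∃ (f g : SchwartzMap (Fin 1 → EuclideanSpace ℝ (Fin 4)) ℂ) (H : SchwartzMap (Fin (1 + 1) → EuclideanSpace ℝ (Fin 4)) ℂ), IsTimeOrdered f ∧ IsTimeOrdered g ∧ IsAppendTensorOf H (osAdjoint f) g ∧ ∃ δ : ℝ, 0 < δ ∧ ∀ᶠ k in Filter.atTop, δ ≤ ‖LS k (1 + 1) H‖) → (∃ Δ : ℝ, 0 < Δ ∧ ∀ (n m : ℕ) (F : SchwartzMap (Fin n → EuclideanSpace ℝ (Fin 4)) ℂ) (G' : SchwartzMap (Fin m → EuclideanSpace ℝ (Fin 4)) ℂ), IsTimeOrdered F → IsTimeOrdered G' → ∃ C : ℝ, ∀ v : EuclideanSpace ℝ (Fin 4), 0 ≤ v 0 → ∀ᶠ k in Filter.atTop, ∀ H : SchwartzMap (Fin (n + m) → EuclideanSpace ℝ (Fin 4)) ℂ, IsAppendTensorOf H (osAdjoint F) (translateMulti v G') → ‖LS k (n +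 m) H - LS k n (osAdjoint F) * LS k m G'‖ ≤ C * Real.exp (-Δ * ‖v‖)) → ∃ (f g h : SchwartzMap (EuclideanSpace ℝ (Fin 4)) ℂ) (F₃ : SchwartzMap (Fin 3 → EuclideanSpace ℝ (Fin 4)) ℂ), IsTensorOf F₃ ![f, g, h] ∧ IsOffDiagonal F₃ ∧ ∃ δ : ℝ, 0 < δ ∧ ∃ᶠ k in Filter.atTop, δ ≤ ‖LS k 3 F₃‖

/-- item stmt-QuantumFields-9119 · crux · rank 6 · open · by planner
why it might fail: hypercubic artefacts are O(a²) only perturbatively (Symanzik: irrelevance of the dimension-6 operators); non-perturbative restoration along a pinned AF sequence is open, and RegularisationDichotomy says no regulator is both reflection positive and SO(4)-invariant.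
sources: DavoudiSavage2012, Symanzik1983, Literature.Barriers.QuantumFields.RegularisationDichotomy, OsterwalderSchrader1975
[crux] IMPORTED COMPLEMENT (E1; lowest crux rank): for every G, r, sch satisfying (VS), (UVB), (ND),
(CL), proper rotations are restored asymptotically on ⁰𝒮: for every off-diagonal n-point tensor F
and every R ∈ SO(4), S_k(R·F − F) → 0 as k → ∞ (S_k is linear in F). Owned by the E1 cards
(coincidence-lattice-rotation-bootstrap, sixteen-mirrors-o4-rigidity, s28-taxicab-anisotropy); this
route only consumes it. Stated as convergence of differences so that non-uniqueness of subsequential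
limits is harmless. [deps: MassiveScalingSequence] [difficulty: open-problem] -/
@[route_item "route-QuantumFields-FlowLineStateSpace"]
def RotationRestoration : Prop :=
  open Literature.MathematicalPhysics.QuantumFieldTheory Literature.MathematicalPhysics.QuantumLattice Literature.MathematicalPhysics.AQFT Literature.Probability.LatticeModels in ∀ (G : Type) [Group G] [TopologicalSpace G] [IsTopologicalGroup G] [CompactSpace G], IsCompactSimpleLieGroup G → letI : MeasurableSpace G := borel G; haveI : BorelSpace G := ⟨rfl⟩; ∀ (r : LatticeRep G) (sch : SpeciesScheme (YMSpecies G)), let μ := fun k : ℕ => wilsonMeasure (d := 4) (L := sch.side k) r.ρ (sch.β k); let LS := fun (k n : ℕ) (F : SchwartzMap (Fin n → EuclideanSpace ℝ (Fin 4)) ℂ) => (∫ U, ∑ x : Fin n → ↥(box 4 (sch.L k)), F (fun i => sch.a k • siteToE ↑(x i)) * ∏ i, ((sch.c r.curvature k * sch.a k ^ 4 * (r.curvature.F (configShift (-↑(x i)) (torusLift (sch.side k) U)) - sch.m r.curvature k) : ℝ) : ℂ) ∂μ k); (∀ k : ℕ, sch.m r.curvature k = ∫ U, r.curvature.F (torusLift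 (sch.side k) U) ∂μ k) → (∃ (s : ℕ) (α β : ℝ), ∀ (n : ℕ) (F : SchwartzMap (Fin n → EuclideanSpace ℝ (Fin 4)) ℂ), IsOffDiagonal F → ∀ᶠ k in Filter.atTop, ‖LS k n F‖ ≤ α * (n.factorial : ℝ) ^ β * schwartzNorm (n * s) F) → (∃ (f g : SchwartzMap (Fin 1 → EuclideanSpace ℝ (Fin 4)) ℂ) (H : SchwartzMap (Fin (1 + 1) → EuclideanSpace ℝ (Fin 4)) ℂ), IsTimeOrdered f ∧ IsTimeOrdered g ∧ IsAppendTensorOf H (osAdjoint f) g ∧ ∃ δ : ℝ, 0 < δ ∧ ∀ᶠ k in Filter.atTop, δ ≤ ‖LS k (1 + 1) H‖) → (∃ Δ : ℝ, 0 < Δ ∧ ∀ (n m : ℕ) (F : SchwartzMap (Fin n → EuclideanSpace ℝ (Fin 4)) ℂ) (G' : SchwartzMap (Fin m → EuclideanSpace ℝ (Fin 4)) ℂ), IsTimeOrdered F → IsTimeOrdered G' → ∃ C : ℝ, ∀ v : EuclideanSpace ℝ (Fin 4), 0 ≤ v 0 → ∀ᶠ k in Filter.atTop, ∀ H : SchwartzMap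 (Fin (n + m) → EuclideanSpace ℝ (Fin 4)) ℂ, IsAppendTensorOf H (osAdjoint F) (translateMulti v G') → ‖LS k (n + m) H - LS k n (osAdjoint F) * LS k m G'‖ ≤ C * Real.exp (-Δ * ‖v‖)) → ∀ (n : ℕ) (F : SchwartzMap (Fin n → EuclideanSpace ℝ (Fin 4)) ℂ), IsOffDiagonal F → ∀ R : EuclideanSpace ℝ (Fin 4) ≃ₗᵢ[ℝ] EuclideanSpace ℝ (Fin 4), LinearMap.det (R.toLinearEquiv : EuclideanSpace ℝ (Fin 4) →ₗ[ℝ] EuclideanSpace ℝ (Fin 4)) = 1 → Filter.Tendsto (fun k : ℕ => LS k n (linActMulti R F - F)) Filter.atTop (nhds 0)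

-- earlier OSLimitFromUniformBounds (stmt-QuantumFields-9120, replaced 2026-08-16T17:35:48Z -> stmt-QuantumFields-15926): retired by None — open Literature.MathematicalPhysics.QuantumFieldTheory Literature.MathematicalPhysics.QuantumLattice Literature.MathematicalPhysics.AQFT Literature.Probability.LatticeModels in ∀ (G : Type) [Group G] [TopologicalSpace G] [IsTopologicalGroup G] [CompactSpace G], I
/-- item stmt-QuantumFields-15926 · crux · rank 9 · open · by planner
why it might fail: Soft but unproved: ONE diagonal subsequence must converge on all of ⁰𝒮 (separability + UVB equicontinuity), a complex non-normed Hahn–Banach step must reach 𝒮-continuous functionals, NG's ∃ᶠ set must contain it; mismatch with the tree's E0'/E2/E4 forms breaks it (β-reindexing clause: rfl for sch∘φ).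
sources: OsterwalderSchrader1975, GlimmJaffe1987, OsterwalderSeiler1978, KravchukQiaoRychkov2021
[crux] Soft assembly (compactness + axioms through the limit; RESTATED 2026-08-16 for the Statement
re-type p116790 `sch.HasWeakCouplingLimit ∧ …`): for every G, r, sch with (VS), (UVB), (ND), (CL),
(ARP), (GAP), the conclusion of CurvatureNonGaussianity and of RotationRestoration, there are sch'
(the subsequence of sch along which all S_k(F) converge, other species renormalised to 0) and T :
OSData (YMSpecies G) 4 with: (SUB — the one new conjunct) sch' is a reindexing of sch IN THE
COUPLING along some φ → ∞, i.e. ∃ φ : ℕ → ℕ, φ → ∞ ∧ ∀ k, sch'.β k = sch.β (φ k) — free for the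
intended construction sch' := sch ∘ φ (c, m of non-curvature species := 0) and the weakest typed
link letting the deciding theorem transfer MassiveScalingSequence's (AF) β_k → ∞ to the witness:
`closes` PROVES sch'.HasWeakCouplingLimit := Tendsto sch'.β atTop atTop as (AF).comp φ; then, as
before, IsYangMillsFor r sch' T, T.IsNontrivial r.curvature, T.IsNonGaussian r.curvature and ∃ Δ >
0, T.HasMassGap Δ ∧ HasLatticeMassGap r sch' Δ. Plan (unchanged): S_k is a continuous linear
functional on 𝓢((ℝ⁴)ⁿ) (finite lattice sums); UVB + Banach–Steinhaus + separability give ONE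
subsequence φ converging on all of ⁰𝒮 f -/
@[route_item "route-QuantumFields-FlowLineStateSpace"]
def OSLimitFromUniformBounds : Prop :=
  open Literature.MathematicalPhysics.QuantumFieldTheory Literature.MathematicalPhysics.QuantumLattice Literature.MathematicalPhysics.AQFT Literature.Probability.LatticeModels in ∀ (G : Type) [Group G] [TopologicalSpace G] [IsTopologicalGroup G] [CompactSpace G], IsCompactSimpleLieGroup G → letI : MeasurableSpace G := borel G; haveI : BorelSpace G := ⟨rfl⟩; ∀ (r : LatticeRep G) (sch : SpeciesScheme (YMSpecies G)), let μ := fun k : ℕ => wilsonMeasure (d := 4) (L := sch.side k) r.ρ (sch.β k); let LS := fun (k n : ℕ) (F : SchwartzMap (Fin n → EuclideanSpace ℝ (Fin 4)) ℂ) => (∫ U, ∑ x : Fin n → ↥(box 4 (sch.L k)), F (fun i => sch.a k • siteToE ↑(x i)) * ∏ i, ((sch.c r.curvature k * sch.a k ^ 4 * (r.curvature.F (configShift (-↑(x i)) (torusLift (sch.side k) U)) - sch.m r.curvature k) : ℝ) : ℂ) ∂μ k); (∀ k : ℕ, sch.m r.curvature k = ∫ U, r.curvature.F (torusLift (sch.side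 k) U) ∂μ k) → (∃ (s : ℕ) (α β : ℝ), ∀ (n : ℕ) (F : SchwartzMap (Fin n → EuclideanSpace ℝ (Fin 4)) ℂ), IsOffDiagonal F → ∀ᶠ k in Filter.atTop, ‖LS k n F‖ ≤ α * (n.factorial : ℝ) ^ β * schwartzNorm (n * s) F) → (∃ (f g : SchwartzMap (Fin 1 → EuclideanSpace ℝ (Fin 4)) ℂ) (H : SchwartzMap (Fin (1 + 1) → EuclideanSpace ℝ (Fin 4)) ℂ), IsTimeOrdered f ∧ IsTimeOrdered g ∧ IsAppendTensorOf H (osAdjoint f) g ∧ ∃ δ : ℝ, 0 < δ ∧ ∀ᶠ k in Filter.atTop, δ ≤ ‖LS k (1 + 1) H‖) → (∃ Δ : ℝ, 0 < Δ ∧ ∀ (n m : ℕ) (F : SchwartzMap (Fin n → EuclideanSpace ℝ (Fin 4)) ℂ) (G' : SchwartzMap (Fin m → EuclideanSpace ℝ (Fin 4)) ℂ), IsTimeOrdered F → IsTimeOrdered G' → ∃ C : ℝ, ∀ v : EuclideanSpace ℝ (Fin 4), 0 ≤ v 0 → ∀ᶠ k in Filter.atTop, ∀ H : SchwartzMap (Fin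 (n + m) → EuclideanSpace ℝ (Fin 4)) ℂ, IsAppendTensorOf H (osAdjoint F) (translateMulti v G') → ‖LS k (n + m) H - LS k n (osAdjoint F) * LS k m G'‖ ≤ C * Real.exp (-Δ * ‖v‖)) → (∀ (N : ℕ) (deg : Fin N → ℕ) (F : (j : Fin N) → SchwartzMap (Fin (deg j) → EuclideanSpace ℝ (Fin 4)) ℂ), (∀ j, IsTimeOrdered (F j)) → ∀ H : (i j : Fin N) → SchwartzMap (Fin (deg i + deg j) → EuclideanSpace ℝ (Fin 4)) ℂ, (∀ i j, IsAppendTensorOf (H i j) (osAdjoint (F i)) (F j)) → ∀ ε : ℝ, 0 < ε → ∀ᶠ k in Filter.atTop, -ε ≤ (∑ i, ∑ j, LS k (deg i + deg j) (H i j)).re ∧ |(∑ i, ∑ j, LS k (deg i + deg j) (H i j)).im| ≤ ε) → (∃ Δ : ℝ, 0 < Δ ∧ HasLatticeMassGap r sch Δ) → (∃ (f g h : SchwartzMap (EuclideanSpace ℝ (Fin 4)) ℂ) (F₃ : SchwartzMap (Fin 3 → EuclideanSpace ℝ (Fin 4)) ℂ), IsTensorOf F₃ ![f, g, h] ∧ IsOffDiagonal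 F₃ ∧ ∃ δ : ℝ, 0 < δ ∧ ∃ᶠ k in Filter.atTop, δ ≤ ‖LS k 3 F₃‖) → (∀ (n : ℕ) (F : SchwartzMap (Fin n → EuclideanSpace ℝ (Fin 4)) ℂ), IsOffDiagonal F → ∀ R : EuclideanSpace ℝ (Fin 4) ≃ₗᵢ[ℝ] EuclideanSpace ℝ (Fin 4), LinearMap.det (R.toLinearEquiv : EuclideanSpace ℝ (Fin 4) →ₗ[ℝ] EuclideanSpace ℝ (Fin 4)) = 1 → Filter.Tendsto (fun k : ℕ => LS k n (linActMulti R F - F)) Filter.atTop (nhds 0)) → ∃ (sch' : SpeciesScheme (YMSpecies G)) (T : OSData (YMSpecies G) 4), (∃ φ : ℕ → ℕ, Filter.Tendsto φ Filter.atTop Filter.atTop ∧ ∀ k : ℕ, sch'.β k = sch.β (φ k)) ∧ IsYangMillsFor r sch' T ∧ T.IsNontrivial r.curvature ∧ T.IsNonGaussian r.curvature ∧ ∃ Δ > 0, T.HasMassGap Δ ∧ HasLatticeMassGap r sch' Δ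

/-- item stmt-QuantumFields-13916 · support · rank 9 · open · by planner
sources: HongTian2004, Hamilton1993, ChenShen1994, KelleherStreets2018, Luscher2010WilsonFlow
[support] (deterministic engine; lattice form of the small-entropy regularity theorem Hong–Tian 2004
Thm 4 = Kelleher–Streets 2018 Thm 15, Chen–Shen 1994, uniform in the lattice flow time; same shape
as route GradientFlowSpecies' LatticeFlowEpsilonRegularity for SU(3), here for every compact simple
G and faithful unitary r) There are ε₀ > 0 and C such that on every torus (ℤ/S)⁴, for every Wilson
flow line B (tree IsWilsonFlowLine), configuration U, site x and lattice flow time t with 1 ≤ t ≤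
S²/64: if the Gaussian-weighted (weight exp(−d(x,y)²/4t), torus distance) unflowed plaquette energy
around x is ≤ ε₀, then the flowed plaquette density at (x,t) is ≤ C/t². By the semigroup property of
the flow (ODE uniqueness) this IS the entropy-form ε-regularity at every physical scale R ≥ a_k:
apply it at lattice time R²/a² to the configuration B_{t−R²}U — 'Φ^{lat}_{(x,t)}(R) ≤ ε₀ ⇒ |F_t(x)|²
≤ C/R⁴'. Continuum proof: Hamilton's monotonicity is EXACT on the flat torus (Hamilton 1993 §3, p.
135–136: Z(t) = (T−t)²∫|F|²k is monotone decreasing when M is Ricci-parallel with weakly positive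
sectional curvature — no global-energy error term, which matters because the ensemble has infinite
total en -/
@[route_item "route-QuantumFields-FlowLineStateSpace"]
def LatticeEntropyEpsilonRegularity : Prop :=
  open Literature.MathematicalPhysics.QuantumFieldTheory Literature.MathematicalPhysics.QuantumLattice in ∀ (G : Type) [Group G] [TopologicalSpace G] [IsTopologicalGroup G] [CompactSpace G], IsCompactSimpleLieGroup G → ∀ (r : LatticeRep G), ∃ ε₀ : ℝ, 0 < ε₀ ∧ ∃ C : ℝ, ∀ (S : ℕ) [NeZero S] (B : ℝ → GaugeConfig 4 S G → GaugeConfig 4 S G), (∀ U : GaugeConfig 4 S G, IsWilsonFlowLine (Set.range r.ρ) (fun e => r.ρ (U e)) (fun s e => r.ρ (B s U e))) → ∀ (U : GaugeConfig 4 S G) (x : Site 4 S) (t : ℝ), 1 ≤ t → 64 * t ≤ (S : ℝ) ^ 2 → (∑ y : Site 4 S, Real.exp (-(∑ i : Fin 4, ((min (x i - y i).val (S - (x i - y i).val) : ℕ) : ℝ) ^ 2) / (4 * t)) * (2 * ∑ i : Fin 4, ∑ j : Fin 4, if i < j then ((r.N : ℝ) - (r.ρ (plaquetteHolonomy U y i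 j)).trace.re) else 0)) ≤ ε₀ → (2 * ∑ i : Fin 4, ∑ j : Fin 4, if i < j then ((r.N : ℝ) - (r.ρ (plaquetteHolonomy (B t U) x i j)).trace.re) else 0) ≤ C / t ^ 2

-- item stmt-QuantumFields-13920 · support · rank 9 · open · by planner — informal only, no Lean statement yet:
--   [support] (replaces FlowedTightnessFromNonConcentration stmt-9457, whose hypothesis '(ii)' no longer
--   exists after the typing of FlowedEnergyNonConcentration; needs D3's FlowLineSpace plus a
--   lattice→continuum embedding of flowed torus fields before it can be typed) TIGHTNESS MODULO GAUGE
--   FROM UNIFORM INTEGRABILITY. Along any t₀-scheme (data and hypotheses of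
--   FlowedEnergyNonConcentration): EntropyNonConcentrationFromUI gives, for every ε₀, window [t₁,t₂] and
--   η, scales R ≤ R₀ with μ_k{Φ^{lat}_{(x,s)}(R) ≥ ε₀} ≤ ηR⁴ eventually in k;
--   LatticeEntropyEpsilonRegularity (applied at lattice time R²t₀ to

-- earlier FlowedEnergyMeanBound (stmt-QuantumFields-13914, replaced 2026-08-16T06:11:54Z -> stmt-QuantumFields-14706): retired by None — open Literature.MathematicalPhysics.QuantumFieldTheory Literature.MathematicalPhysics.QuantumLattice Literature.Probability.LatticeModels in ∀ (G : Type) [Group G] [TopologicalSpace G] [IsTopologicalGroup G] [CompactSpace G], IsCompactSimpleLieGroup G → letI : Meas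
/-- item stmt-QuantumFields-14706 · support · rank 9 · closed · proved by Summit.QuantumFields.YangMills.Theorems.flowedEnergyMeanBound_proof (prover) · by planner
sources: Luscher2010WilsonFlow, LuscherWeisz2011
[support] (first lemma of the tier-deciding crux: 'Markov is free') Same data and hypotheses as
FlowedEnergyNonConcentration (torus Wilson flow lines B_k, flowed plaquette density e_k, t₀(k) =
inf{τ > 0 : τ²⟨e_τ⟩ ≥ 3/10} of its expectation (= flowScaleOf, inlined 2026-08-16; defeq restatement
of stmt-13914), t₀ > 0, t₀ → ∞, L_k/√t₀ → ∞). For every k and every physical flow time s > 0: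
min(s,1)²·E_k[t₀(k)²·e_k(s·t₀(k),0)] ≤ 3/10. The s < 1 half IS the definition of t₀ as the least
crossing time (tree sq_mul_lt_of_lt_flowScaleOf + integral_const_mul; proved in 8 lines in the
planner's SanityMean.lean, rc 0, no flow facts); the s ≥ 1 half uses attainment t₀²⟨e_{t₀}⟩ = 3/10
(flowScaleOf_spec: the profile is continuous in τ, bounded by 24N, and the level is reached since t₀
> 0) and monotonicity of τ ↦ ⟨e_τ(0)⟩ = (2/|Λ|)⟨wilsonAction r.ρ (B τ U)⟩, i.e. translation
invariance of the torus Wilson measure, flow equivariance from ODE uniqueness on the finite torus,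
and Lüscher p. 2 'the action S_w(V_t) is a monotonically decreasing function of t' (the flow is the
gradient flow of the Wilson action) — exactly the deferred follow-up facts of
defn-latticeWilsonFlow. Consequence: E_k[Φ^{lat}_{( -/
@[route_item "route-QuantumFields-FlowLineStateSpace"]
def FlowedEnergyMeanBound : Prop :=
  open Literature.MathematicalPhysics.QuantumFieldTheory Literature.MathematicalPhysics.QuantumLattice Literature.Probability.LatticeModels in ∀ (G : Type) [Group G] [TopologicalSpace G] [IsTopologicalGroup G] [CompactSpace G], IsCompactSimpleLieGroup G → letI : MeasurableSpace G := borel G; haveI : BorelSpace G := ⟨rfl⟩; ∀ (r : LatticeRep G) (β : ℕ → ℝ) (L : ℕ → ℕ) (B : (k : ℕ) → ℝ → GaugeConfig 4 (2 * L k + 1) G → GaugeConfig 4 (2 * L k + 1) G), (∀ (k : ℕ) (U : GaugeConfig 4 (2 * L k + 1) G), IsWilsonFlowLine (Set.range r.ρ) (fun e => r.ρ (U e)) (fun s e => r.ρ (B k s U e))) → let μ := fun k : ℕ => wilsonMeasure (d := 4) (L := 2 * L k + 1) r.ρ (β k); let e := fun (k : ℕ) (τ : ℝ) (x : Site 4 (2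 * L k + 1)) (U : GaugeConfig 4 (2 * L k + 1) G) => (2 * ∑ i : Fin 4, ∑ j : Fin 4, if i < j then ((r.N : ℝ) - (r.ρ (plaquetteHolonomy (B k τ U) x i j)).trace.re) else 0 : ℝ); let t0 := fun k : ℕ => sInf {τ : ℝ | 0 < τ ∧ 3 / 10 ≤ τ ^ 2 * ∫ U, e k τ 0 U ∂μ k}; (∀ k, 0 < t0 k) → Filter.Tendsto t0 Filter.atTop Filter.atTop → Filter.Tendsto (fun k : ℕ => (L k : ℝ) / Real.sqrt (t0 k)) Filter.atTop Filter.atTop → ∀ (k : ℕ) (s : ℝ), 0 < s → (min s 1) ^ 2 * ∫ U, t0 k ^ 2 * e k (s * t0 k) 0 U ∂μ k ≤ 3 / 10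

-- `FlowedEnergyMeanBound` holds: proved by `Summit.QuantumFields.YangMills.Theorems.flowedEnergyMeanBound_proof` (its module imports this route file, so no `_holds` link can be stated here).

-- earlier EntropyNonConcentrationFromUI (stmt-QuantumFields-13919, replaced 2026-08-15T23:35:22Z -> stmt-QuantumFields-13980): retired by None — FlowedEnergyNonConcentration → open Literature.MathematicalPhysics.QuantumFieldTheory Literature.MathematicalPhysics.QuantumLattice Literature.Probability.LatticeModels in ∀ (G : Type) [Group G] [TopologicalSpace G] [IsTopologicalGroup G] [CompactSpace G], 
-- earlier EntropyNonConcentrationFromUI (stmt-QuantumFields-13980, replaced 2026-08-16T00:17:38Z -> stmt-QuantumFields-14095): retired by None — FlowedEnergyNonConcentration → open Literature.MathematicalPhysics.QuantumFieldTheory Literature.MathematicalPhysics.QuantumLattice Literature.Probability.LatticeModels in ∀ (G : Type) [Group G] [TopologicalSpace G] [IsTopologicalGroup G] [CompactSpace G], 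
-- earlier EntropyNonConcentrationFromUI (stmt-QuantumFields-14095, replaced 2026-08-16T06:11:54Z -> stmt-QuantumFields-14707): retired by None — open Literature.MathematicalPhysics.QuantumFieldTheory Literature.MathematicalPhysics.QuantumLattice Literature.Probability.LatticeModels in ∀ (G : Type) [Group G] [TopologicalSpace G] [IsTopologicalGroup G] [CompactSpace G], IsCompactSimpleLieGroup G → let
/-- item stmt-QuantumFields-14707 · support · rank 9 · closed · proved by Summit.QuantumFields.YangMills.Theorems.entropyNonConcentrationFromUI_proof (prover) · by planner
sources: HongTian2004, KelleherStreets2018, Struwe1994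
[support] (the reduction 'uniform integrability ⇒ little-o over Markov', typed; RESTATED 2026-08-16
as the INSTANCE-WISE lemma that refuter g47-1 advised and that survives any future re-quantification
of the crux: no reference to FlowedEnergyNonConcentration, no H_min, no H_AF — with the previous '∀
r of minimal dimension' conclusion it became FALSE after the crux's ∃ r repair, by the Spin(20)
defect gas of refuter rattack-13977-0: one flow-stable defect within R√t₀ of x already gives Φ ≥ ε₀
with probability Θ(R⁴)) For every compact simple G, faithful unitary r, couplings β_k, half-sides
L_k and torus Wilson flow lines B_k (tree IsWilsonFlowLine) with e_k, t₀(k) = inf{τ > 0 : τ²⟨e_τ⟩ ≥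
3/10} as in the crux (flowScaleOf inlined 2026-08-16; defeq restatement of stmt-14095) and t₀(k) >
0, t₀(k) → ∞, L_k/√t₀ → ∞: IF the physical densities t₀²e_k(s·t₀,0) are uniformly integrable on
every window (∀[t₁,t₂] ∀δ ∃Λ ∀k ∀s∈[t₁,t₂], E_k[(t₀²e_k(s t₀,0) − Λ)₊] ≤ δ — verbatim the crux's
conclusion FOR THIS DATA), THEN for every ε₀ > 0, window [t₁,t₂] ⊂ (0,∞) and η > 0 there is R₀ > 0
such that for 0 < R ≤ R₀, eventually in k, for all sites x and s ∈ [t₁,t₂]: μ_k{U :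
Φ^{lat}_{(x,s)}(R) := Σ_y exp( -/
@[route_item "route-QuantumFields-FlowLineStateSpace"]
def EntropyNonConcentrationFromUI : Prop :=
  open Literature.MathematicalPhysics.QuantumFieldTheory Literature.MathematicalPhysics.QuantumLattice Literature.Probability.LatticeModels in ∀ (G : Type) [Group G] [TopologicalSpace G] [IsTopologicalGroup G] [CompactSpace G], IsCompactSimpleLieGroup G → letI : MeasurableSpace G := borel G; haveI : BorelSpace G := ⟨rfl⟩; ∀ (r : LatticeRep G) (β : ℕ → ℝ) (L : ℕ → ℕ) (B : (k : ℕ) → ℝ → GaugeConfig 4 (2 * L k + 1) G → GaugeConfig 4 (2 * L k + 1) G), (∀ (k : ℕ) (U : GaugeConfig 4 (2 * L k + 1) G), IsWilsonFlowLine (Set.range r.ρ) (fun e => r.ρ (U e)) (fun s e => r.ρ (B k s U e))) → let μ := fun k : ℕ => wilsonMeasure (d := 4) (L := 2 * L k + 1) r.ρ (β k); let e := fun (k : ℕ) (τ : ℝ) (x : Site 4 (2 * L k + 1)) (U : GaugeConfig 4 (2 * L k + 1) G) => (2 * ∑ i : Fin 4, ∑ j : Fin 4, if i < j then ((r.N :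 ℝ) - (r.ρ (plaquetteHolonomy (B k τ U) x i j)).trace.re) else 0 : ℝ); let t0 := fun k : ℕ => sInf {τ : ℝ | 0 < τ ∧ 3 / 10 ≤ τ ^ 2 * ∫ U, e k τ 0 U ∂μ k}; (∀ k, 0 < t0 k) → Filter.Tendsto t0 Filter.atTop Filter.atTop → Filter.Tendsto (fun k : ℕ => (L k : ℝ) / Real.sqrt (t0 k)) Filter.atTop Filter.atTop → (∀ t₁ t₂ : ℝ, 0 < t₁ → t₁ ≤ t₂ → ∀ δ : ℝ, 0 < δ → ∃ Λ : ℝ, ∀ (k : ℕ) (s : ℝ), s ∈ Set.Icc t₁ t₂ → ∫ U, max (t0 k ^ 2 * e k (s * t0 k) 0 U - Λ) 0 ∂μ k ≤ δ) → ∀ ε₀ : ℝ, 0 < ε₀ → ∀ t₁ t₂ : ℝ, 0 < t₁ → t₁ ≤ t₂ → ∀ η : ℝ, 0 < η → ∃ R₀ : ℝ, 0 < R₀ ∧ ∀ R : ℝ, 0 < R → R ≤ R₀ → ∀ᶠ k in Filter.atTop, ∀ (x : Site 4 (2 * L k + 1)) (s : ℝ), s ∈ Set.Icc t₁ t₂ →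 (μ k).real {U | ε₀ ≤ ∑ y : Site 4 (2 * L k + 1), Real.exp (-(∑ i : Fin 4, ((min (x i - y i).val (2 * L k + 1 - (x i - y i).val) : ℕ) : ℝ) ^ 2) / (4 * R ^ 2 * t0 k)) * e k ((s - R ^ 2) * t0 k) y U} ≤ η * R ^ 4

-- `EntropyNonConcentrationFromUI` holds: proved by `Summit.QuantumFields.YangMills.Theorems.entropyNonConcentrationFromUI_proof` (its module imports this route file, so no `_holds` link can be stated here).

-- earlier FlowedEnergyMomentBound (stmt-QuantumFields-13915, replaced 2026-08-15T23:35:51Z -> stmt-QuantumFields-13981): retired by None — open Literature.MathematicalPhysics.QuantumFieldTheory Literature.MathematicalPhysics.QuantumLattice Literature.Probability.LatticeModels in ∀ (G : Type) [Group G] [TopologicalSpace G] [IsTopologicalGroup G] [CompactSpace G], IsCompactSimpleLieGroup G → letI : Me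
-- earlier FlowedEnergyMomentBound (stmt-QuantumFields-13981, replaced 2026-08-16T00:18:05Z -> stmt-QuantumFields-14096): retired by None — open Literature.MathematicalPhysics.QuantumFieldTheory Literature.MathematicalPhysics.QuantumLattice Literature.Probability.LatticeModels in ∀ (G : Type) [Group G] [TopologicalSpace G] [IsTopologicalGroup G] [CompactSpace G], IsCompactSimpleLieGroup G → letI : Me
-- earlier FlowedEnergyMomentBound (stmt-QuantumFields-14096, replaced 2026-08-16T06:11:54Z -> stmt-QuantumFields-14708): retired by None — open Literature.MathematicalPhysics.QuantumFieldTheory Literature.MathematicalPhysics.QuantumLattice Literature.Probability.LatticeModels in ∀ (G : Type) [Group G] [TopologicalSpace G] [IsTopologicalGroup G] [CompactSpace G], IsCompactSimpleLieGroup G → letI : Me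
/-- item stmt-QuantumFields-14708 · support · rank 9 · open · by planner
sources: LuscherWeisz2011, tHooft1976, SmithTeper1998, Luscher2010WilsonFlow
[support] (STRONGER sufficient form of the tier-deciding crux; a refuter-friendly calibration
target; RESTATED 2026-08-16 in the same '∃ r per G' shape as the repaired crux — as '∀ r of minimal
dimension' it fell, for EVERY p > 1, to the Spin(20) witness of refuter rattack-13977-0 (r = 20 ⊕
512 forced by minimality; metastable central plaquette, defect gas, X → 0 in probability with E X ≡
0.3 forces E X^p → ∞), exactly as the all-r typing fell to g47-1's spin-3/2 gas; both are lattice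
artefacts of representations with a relevant metastable plaquette, NOT the 'refutation for all p > 1
along a good r' that the kill criteria call the route's kill) For every compact simple G there is a
faithful unitary lattice rep r such that for all β_k → ∞, L_k, torus flow lines B_k with the
t₀-scheme conditions (data and hypotheses of FlowedEnergyNonConcentration; t₀ = inf{τ > 0 : τ²⟨e_τ⟩
≥ 3/10} inlined 2026-08-16, defeq restatement of stmt-14096) and every window [t₁,t₂] ⊂ (0,∞) there
are p > 1 and C with E_k[(t₀(k)² e_k(s t₀(k),0))^p] ≤ C for all k and s ∈ [t₁,t₂]. Implies
FlowedEnergyNonConcentration with the same r (de la Vallée-Poussin: (x−Λ)₊ ≤ x^p Λ^{1−p};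
`momentR_of_filed`-type bookkeeping -/
@[route_item "route-QuantumFields-FlowLineStateSpace"]
def FlowedEnergyMomentBound : Prop :=
  open Literature.MathematicalPhysics.QuantumFieldTheory Literature.MathematicalPhysics.QuantumLattice Literature.Probability.LatticeModels in ∀ (G : Type) [Group G] [TopologicalSpace G] [IsTopologicalGroup G] [CompactSpace G], IsCompactSimpleLieGroup G → letI : MeasurableSpace G := borel G; haveI : BorelSpace G := ⟨rfl⟩; ∃ r : LatticeRep G, ∀ (β : ℕ → ℝ) (L : ℕ → ℕ) (B : (k : ℕ) → ℝ → GaugeConfig 4 (2 * L k + 1) G → GaugeConfig 4 (2 * L k + 1) G), (∀ (k : ℕ) (U : GaugeConfig 4 (2 * L k + 1) G), IsWilsonFlowLine (Set.range r.ρ) (fun e => r.ρ (U e)) (fun s e => r.ρ (B k s U e))) → let μ := fun k : ℕ => wilsonMeasure (d := 4) (L := 2 * L k + 1) r.ρ (β k); let e := fun (k : ℕ) (τ : ℝ) (x : Site 4 (2 * L k + 1)) (U : GaugeConfig 4 (2 * L k + 1) G) => (2 * ∑ i : Fin 4, ∑ j : Fin 4, if i < j then ((r.N : ℝ) - (r.ρ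 (plaquetteHolonomy (B k τ U) x i j)).trace.re) else 0 : ℝ); let t0 := fun k : ℕ => sInf {τ : ℝ | 0 < τ ∧ 3 / 10 ≤ τ ^ 2 * ∫ U, e k τ 0 U ∂μ k}; Filter.Tendsto β Filter.atTop Filter.atTop → (∀ k, 0 < t0 k) → Filter.Tendsto t0 Filter.atTop Filter.atTop → Filter.Tendsto (fun k : ℕ => (L k : ℝ) / Real.sqrt (t0 k)) Filter.atTop Filter.atTop → ∀ t₁ t₂ : ℝ, 0 < t₁ → t₁ ≤ t₂ → ∃ p : ℝ, 1 < p ∧ ∃ C : ℝ, ∀ (k : ℕ) (s : ℝ), s ∈ Set.Icc t₁ t₂ → ∫ U, (t0 k ^ 2 * e k (s * t0 k) 0 U) ^ p ∂μ k ≤ C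

-- item stmt-QuantumFields-9458 · support · rank 9 · open · by planner — informal only, no Lean statement yet:
--   [support] (card P1) Wilson's action is reflection positive in all four families of lattice
--   hyperplanes (site and link reflections; tree TorusSiteRP / TorusOddRP / TorusLoopLinkRP /
--   WilsonSiteRPForm). FILS chessboard estimate on the 4-torus of side 2^j·b: for block-local bounded F
--   ≥ 0, E ∏_α e^{F∘θ_α} ≤ ∏_α (E ∏_{α'} e^{F_α∘θ_{α'}})^{1/N}; with exponential Chebyshev this bounds
--   the non-concentration probabilities FlowedEnergyNonConcentration(ii) and the box exponential moments
--   (i) by constrained partition functions (1/|Λ|) log Z(h Σ_blocks E_t^{trunc})/Z with the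
--   block-truncated flowed energy i

-- item stmt-QuantumFields-9459 · support · rank 9 · open · by planner — informal only, no Lean statement yet:
--   [support] (card K3; needs D1, D3 and the cite fact Waldron arXiv:1610.03424 Thm 1.1) Identification
--   of the state space: along a tight family (FlowedTightnessFromNonConcentration), the lattice Wilson
--   flow converges to the continuum Yang–Mills heat flow uniformly on compact sets of smooth initial
--   data (consistency of the discretisation, using one extra derivative of room: flow from t to t' > t),
--   so every subsequential limit is ONE probability law on C((0,∞); 𝒜/𝒢) — gauge orbits of immortal flow
--   lines, well defined because the 4-d Yang–Mills flow from smooth finite-energy data on a compact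
--   4-mani

/-- item stmt-QuantumFields-9121 · assembly · rank 1 · closed · proved by Summit.QuantumFields.YangMills.Theorems.flowLineStateSpace_assembly_proof (prover) · by planner
sources: JaffeWitten2000, OsterwalderSchrader1975
[assembly] MassiveScalingSequence → CurvatureNonGaussianity → RotationRestoration →
OSLimitFromUniformBounds → YangMills. -/
@[route_item "route-QuantumFields-FlowLineStateSpace"]
def Assembly : Prop :=
  MassiveScalingSequence → CurvatureNonGaussianity → RotationRestoration → OSLimitFromUniformBounds → YangMills

-- `Assembly` holds: proved by `Summit.QuantumFields.YangMills.Theorems.flowLineStateSpace_assembly_proof` (its module imports this route file, so no `_holds` link can be stated here).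

/-! D-0027 §2.1 — DECIDING THEOREM (planner-authored via `route open/edit --closes-file`; by planner-rrepair-QuantumFields-FlowLineStateSpa-f1598c89-0 2026-08-16T17:35:48Z):
its hypotheses are this route's items and its conclusion the sub-problem Statement (glue_lint), and it elaborates with this file. -/

/-- Deciding theorem (D-0027 §2.1): the four CRUX items imply `YangMills` by pure logic — fix `G`;
`MassiveScalingSequence` yields `r`, `sch` with (AF, VS, UVB, ND, CL, ARP, GAP);
`CurvatureNonGaussianity` and `RotationRestoration` turn (VS, UVB, ND, CL) into the
three-point witness and asymptotic SO(4)-restoration; `OSLimitFromUniformBounds` (crux since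
2026-08-16: unproved and load-bearing; restated 2026-08-16 for the Statement re-type p116790)
assembles `sch'`, `T : OSData (YMSpecies G) 4` with `IsYangMillsFor`, non-triviality,
non-Gaussianity and both gaps, TOGETHER WITH the reindexing clause `sch'.β = sch.β ∘ φ`, `φ → ∞`;
the new first conjunct `sch'.HasWeakCouplingLimit` of `YangMills` is then PROVED here from the
route's asymptotic-freedom input (AF) `sch.β → ∞` of `MassiveScalingSequence` (composition of
`Tendsto`s) — (AF) is no longer idle in the deciding theorem. -/
@[closes "route-QuantumFields-FlowLineStateSpace"] theorem closes (hMSS : MassiveScalingSequence) (hNG : CurvatureNonGaussianity)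
    (hROT : RotationRestoration) (hOSL : OSLimitFromUniformBounds) : YangMills := by
  intro G _ _ _ _ hG
  obtain ⟨r, sch, hAF, hVS, hUVB, hND, hCL, hARP, hGAP⟩ := hMSS G hG
  have hNG' := hNG G hG r sch hVS hUVB hND hCL
  have hROT' := hROT G hG r sch hVS hUVB hND hCL
  obtain ⟨sch', T, ⟨φ, hφ, hβ⟩, hYM, hNT, hNGs, hGap⟩ :=
    hOSL G hG r sch hVS hUVB hND hCL hARP hGAP hNG' hROT'
  refine ⟨r, sch', T, ?_, hYM, hNT, hNGs, hGap⟩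
  have hb : sch'.β = sch.β ∘ φ := funext hβ
  show Filter.Tendsto sch'.β Filter.atTop Filter.atTop
  rw [hb]
  exact hAF.comp hφ

end Summit.QuantumFields.YangMills.Theses.FlowLineStateSpace
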